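import Mathlib
import HarnessLib

/-!
# Programme V3U: the two-piece stable affine cover `{O_a, W_b = ⋂_g g·O_b}` (generic group-action lemma)

(crux stmt-ResolutionOfSingularities-15640 `WildQuotients.WildQuotientResolution`, line `Sketch`,
sector `|G| = p`; programme V3U of `L/w45c/CHAIN.md` v5 §4 row stub-2 «cover»;
[OURS · L1 W4.5c] — NOT a statement of any manuscript.)

For a finite group `G` acting on a separated scheme `V` and opens `A ⊔ B = ⊤` with `A` stable and
`B` affine, the intersection `W = ⋂_g g⁻¹ B` of the translates of `B` is an affine, `G`-stable open
contained in `B` with `A ⊔ W = ⊤` (a point outside the stable `A` has its whole orbit in `B`).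
Applied to `V = Bl_{(x_a,x_b²)} 𝔸ⁿ`, `A = D₊(x_a t)` (stable: `x_a` is invariant), `B = D₊(x_b² t)`:
the glued quotient `V/σ` is the union of the two affine pieces `A/σ` (the `A₁`-cone) and `W/σ`
(regular, `W ⊆ D₊(x_b² t)` where the augmentation ideal is `(x_b)`), as the V3U exit requires.
-/

-- single-problem summit: the doubled namespace component `ResolutionOfSingularities` is forced
set_option linter.dupNamespace false

noncomputable section

open CategoryTheory AlgebraicGeometry TopologicalSpace

namespace Summit.ResolutionOfSingularities.ResolutionOfSingularities.Theorems.WildQuotientResolution.ToricExit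

universe u

/-- **The intersection of the translates of an open is stable.** [folklore] -/
theorem preimage_iInf_preimage_eq {V : Scheme.{u}} {G : Type*} [Group G] [Finite G]
    (ρ : G →* Aut V) (B : V.Opens) (h : G) :
    (ρ h).hom ⁻¹ᵁ (⨅ g : G, (ρ g).hom ⁻¹ᵁ B) = ⨅ g : G, (ρ g).hom ⁻¹ᵁ B := by
  have hcoe : (((⨅ g : G, (ρ g).hom ⁻¹ᵁ B) : V.Opens) : Set V) =
      ⋂ g : G, (ρ g).hom.base ⁻¹' (B : Set V) := by
    rw [Opens.coe_iInf]
    rfl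
  ext1
  rw [Opens.map_coe, hcoe, Set.preimage_iInter]
  have e : ∀ g : G, (ρ h).hom.base ⁻¹' ((ρ g).hom.base ⁻¹' (B : Set V)) =
      (ρ (g * h)).hom.base ⁻¹' (B : Set V) := by
    intro g
    rw [← Set.preimage_comp, map_mul, Aut.Aut_mul_def, Iso.trans_hom]
    rfl
  simp_rw [e]
  exact (Equiv.mulRight h).iInf_comp (g := fun g : G => (ρ g).hom.base ⁻¹' (B : Set V))

/-- The intersection of the translates lies in the open (`g = 1`). [folklore] -/
theorem iInf_preimage_le {V : Scheme.{u}} {G : Type*} [Group G] (ρ : G →* Aut V) (B : V.Opens) :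
    (⨅ g : G, (ρ g).hom ⁻¹ᵁ B) ≤ B := by
  refine (iInf_le (fun g : G => (ρ g).hom ⁻¹ᵁ B) 1).trans (le_of_eq ?_)
  rw [map_one]
  rfl

/-- **A point outside a stable open has its whole orbit in the complementary open**: if
`A ⊔ B = ⊤` and `A` is `G`-stable then `A ⊔ ⋂_g g⁻¹B = ⊤`. [folklore] -/
theorem sup_iInf_preimage_eq_top {V : Scheme.{u}} {G : Type*} [Group G] [Finite G]
    (ρ : G →* Aut V) (A B : V.Opens) (hA : ∀ g : G, (ρ g).hom ⁻¹ᵁ A = A) (hAB : A ⊔ B = ⊤) :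
    A ⊔ (⨅ g : G, (ρ g).hom ⁻¹ᵁ B) = ⊤ := by
  have hcoe : (((⨅ g : G, (ρ g).hom ⁻¹ᵁ B) : V.Opens) : Set V) =
      ⋂ g : G, (ρ g).hom.base ⁻¹' (B : Set V) := by
    rw [Opens.coe_iInf]
    rfl
  ext v
  simp only [Opens.coe_sup, Opens.coe_top, Set.mem_union, SetLike.mem_coe, Set.mem_univ, iff_true]
  by_cases hv : v ∈ A
  · exact Or.inl hv
  · refine Or.inr ?_
    change v ∈ (((⨅ g : G, (ρ g).hom ⁻¹ᵁ B) : V.Opens) : Set V)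
    rw [hcoe]
    refine Set.mem_iInter.mpr fun g => ?_
    -- `g • v ∉ A` (stability), hence `g • v ∈ B`
    have hgv : (ρ g).hom.base v ∉ A := by
      intro h
      apply hv
      have : v ∈ (ρ g).hom ⁻¹ᵁ A := h
      rwa [hA g] at this
    have htop : (ρ g).hom.base v ∈ ((A ⊔ B : V.Opens) : Set V) := by
      rw [hAB]; exact Set.mem_univ _
    rcases htop with h | h
    · exact absurd h hgv
    · exact h

/-- **The two-piece stable affine cover** (V3U «cover»): `G` finite acting on a separated scheme
`V`, `A ⊔ B = ⊤` with `A` stable and `B` affine ⇒ `W = ⋂_g g⁻¹B` is an AFFINE `G`-stable open,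
`W ⊆ B`, and `A ⊔ W = ⊤`. (With `A = D₊(x_a t)`, `B = D₊(x_b² t)` on `Bl_{(x_a,x_b²)} 𝔸ⁿ`:
`V/σ = A/σ ∪ W/σ`, the cone piece and a regular piece.) [folklore] -/
theorem exists_stable_affine_cover_pair {V : Scheme.{u}} [V.IsSeparated] {G : Type*} [Group G]
    [Finite G] (ρ : G →* Aut V) (A B : V.Opens) (hA : ∀ g : G, (ρ g).hom ⁻¹ᵁ A = A)
    (hB : IsAffineOpen B) (hAB : A ⊔ B = ⊤) :
    IsAffineOpen (⨅ g : G, (ρ g).hom ⁻¹ᵁ B) ∧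
      (∀ h : G, (ρ h).hom ⁻¹ᵁ (⨅ g : G, (ρ g).hom ⁻¹ᵁ B) = ⨅ g : G, (ρ g).hom ⁻¹ᵁ B) ∧
      (⨅ g : G, (ρ g).hom ⁻¹ᵁ B) ≤ B ∧ A ⊔ (⨅ g : G, (ρ g).hom ⁻¹ᵁ B) = ⊤ := by
  refine ⟨?_, preimage_iInf_preimage_eq ρ B, iInf_preimage_le ρ B,
    sup_iInf_preimage_eq_top ρ A B hA hAB⟩
  exact IsAffineOpen.iInf fun g => hB.preimage (ρ g).hom

end Summit.ResolutionOfSingularities.ResolutionOfSingularities.Theorems.WildQuotientResolution.ToricExit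

end
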